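import Literature.AlgebraicGeometry.Frobenioids.ModelFrobenioid
import Literature.AlgebraicGeometry.Frobenioids.MonoidFunctorsOnD
import Literature.AnabelianGeometry.EtaleTheta.DivisorMonoidsOfGaloisCoveringConnected
import HarnessLib

/-!
# [EtTh] Remark 4.1.1, second clause — its three descent inputs (Q), (Φ), (B) HOLD at the genuine
# Def. 3.3 (iii) data of the coverings dominated by one universal combinatorial covering

S. Mochizuki, *The étale theta function …*, Publ. RIMS **45** (2009) [MochizukiEtTh2009], §4, Remark 4.1.1,
PDF p.88 (printed p.314) [cite: MochizukiEtTh2009, Rmk 4.1.1 p.88]: "if `α : A → B` is of base-Frobenius type,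
then … `A → B` is a categorical quotient … of `A` by the subgroup `G · μ_N(A) ⊆ Aut_C(A)`"; Def. 3.3 (iii)
p.73 (printed p.299): "`Φ₀(Y^log) := lim Div⁺(Z^log_∞)^{Gal(Z^log_∞/Y^log)}`; `B₀(Y^log) := lim
Mero(Z^log_∞)^{Gal(Z^log_∞/Y^log)}`".  S. Mochizuki, *Semi-graphs of anabelioids*, Publ. RIMS **42** (2006)
[MochizukiSemiAnbd2006], Remark 3.1.3 p.34: the Galois objects of `B^temp(Π)` are the `Π/N`, `N` open normal,
with `Aut(Π/N) = Π/N` acting (simply) transitively.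

abc-iut cell, block F, seat abc-iut-f-108 (gen 3), FACT-LIST row F-0729 (`BiKummerSetting.Remark411`).
PROOF-ONLY companion (no definition, no instance, no new named fact) of
`Discharge/Sec4Remark411Quotient.lean` (abc-iut-f-108 gen 0: conjunct (2) of Remark 4.1.1 REDUCED, for every
§4 setting, to three Galois-descent inputs along `p := Base(α)` — (Q) deck-invariant base arrows out of the
Galois object `A^bs` factor uniquely through `p`; (Φ) deck-invariant elements of the divisor monoid descend along
`p` and pull-back is injective; (B) the same for the rational-function monoid —
`BaseFrobeniusTypeData.existsUnique_fac_of_descent`) and of abc-iut-w5-d179-lineage's CONSTRUCTED Def. 3.3 (iii)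
data `LogDivisorModel.GaloisAction.PhiZero / BZero`, `DivisorMonoids.ofGaloisAction(Connected)`
(`DivisorMonoidsOfGaloisCovering(Connected).lean`): the coverings of `X^log` dominated by `Z^log_∞` as `G`-sets,
`G = Gal(Z^log_∞/X^log)`, with `Φ₀(S) = Hom_G(S, Div⁺(Z^log_∞))`, `B₀(S) = Hom_G(S, Mero(Z^log_∞))`.

WHAT IS PROVED (everything below is a theorem; hypotheses are data or elementary):

* §1 `G`-sets.  For a covering map `f : S → S′` whose deck transformations (automorphisms `σ` of `S` with
  `σ ≫ f = f`) act TRANSITIVELY ON THE FIBRES of `f` (`hdeck`), every deck-invariant function on `S` is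
  constant on the fibres, hence — `f` surjective — descends uniquely to `S′`, equivariantly
  (`apply_eq_of_deckInvariant`, `exists_descent`, `descent_equivariant`).  A GALOIS `G`-set (`G`-transitive
  and `Aut`-transitive — [SemiAnbd] Rmk. 3.1.3) is deck-transitive over EVERY covering map
  (`exists_deck_of_galois`); the regular `G`-set `G/1` (`= Z^log_∞`) and the coset `G`-sets `G/N`, `N ⊴ G`
  (the Galois coverings `Y^log` of `X^log` dominated by `Z^log_∞`) are Galois
  (`exists_aut_apply_eq_leftRegular`, `exists_aut_apply_eq_quotient`).
* §2 (Q) «categorical quotient»: a deck-invariant covering map `q : S → Y` factors UNIQUELY through `f`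
  (`existsUnique_fac_of_deckInvariant`) — [FrdI] §0's categorical quotient of `S` by its deck group, in the
  category of `G`-sets.
* §3 (Φ), (B): deck-invariant elements of `Φ₀(S)`, `B₀(S)` descend uniquely along `f`
  (`phiZero_existsUnique_descent`, `bZero_existsUnique_descent`), and in the `pull`-shape of (Φ)/(B) of
  `existsUnique_fac_of_descent` (`phiZero_galoisDescent`, `bZero_galoisDescent`: descent ∧ injectivity of
  `pull`, resp. of `pullGp` for `Φ₀`).
* §4 the same for the assembled record `DivisorMonoids.ofGaloisAction A hZ`.  The sequel
  `Sec4Remark411DescentOfGaloisActionConnected.lean` carries (Q)/(Φ)/(B) to Def. 3.3's `D₀` proper (the CONNECTED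
  coverings, `DivisorMonoids.ofGaloisActionConnected`), where surjectivity of covering maps is automatic.

So the residual inputs of F-0729's conjunct (2) at the genuine base (abc-iut-f-108 gen 2,
`remark411_mkOfConnectedTemperoid_of_galoisDescent`: (Φ)/(B) descent of the Def. 3.6 data along `Base(α)`) are
TRUE for print's Def. 3.3 (iii) formulas at one term of the inductive limit; what keeps them hypotheses there
is only that the tree's §4 setting is based on `B^temp(Π^tp_X)⁰` with ABSTRACT divisor data
(`RealifiedDivisorMonoids`), not on this constructed data (TODO-merge(abc-iut-L3-t2): the limit over
`Δ^fil`-closures).  HONEST FRAMING: elementary `G`-set descent; nothing here bears on [IUTchIII] Cor. 3.12;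
typed ≠ proved for Remark 4.1.1 itself at the genuine tempered Frobenioid of a curve.
-/

namespace Literature.AnabelianGeometry.EtaleTheta

open CategoryTheory Opposite Literature.AlgebraicGeometry.Frobenioids

universe u

namespace LogDivisorModel.GaloisAction

variable {G : Type u} [Group G] {S S' : Action (Type u) G}

/-! ## §1 `G`-sets: equivariance, deck transformations, Galois `G`-sets -/

/-- Morphisms of `G`-sets are equivariant, pointwise. [cite: MochizukiEtTh2009, Def 3.3 p.73] -/
theorem map_ρ_apply (f : S ⟶ S') (g : G) (s : S.V) : f.hom (S.ρ g s) = S'.ρ g (f.hom s) := by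
  have h := f.comm g
  exact congrFun (congrArg (fun φ : S.V ⟶ S'.V => (φ : S.V → S'.V)) h) s

/-- **A Galois `G`-set is deck-transitive over every covering map**: if `G` acts transitively on `S` and the
automorphisms of the `G`-set `S` act transitively on `S` ([SemiAnbd] Rmk. 3.1.3: `Aut(Π/N) = Π/N`), then for
every covering map `f : S → S′` and every two points of one fibre of `f` there is an automorphism `σ` of `S`
OVER `f` (`σ ≫ f = f`) carrying the one to the other. [cite: MochizukiSemiAnbd2006, Rmk. 3.1.3 p.34] -/
theorem exists_deck_of_galois (htrans : ∀ s t : S.V, ∃ g : G, S.ρ g s = t)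
    (hAut : ∀ s t : S.V, ∃ σ : Aut S, σ.hom.hom s = t) (f : S ⟶ S') {s₁ s₂ : S.V}
    (h : f.hom s₁ = f.hom s₂) : ∃ σ : Aut S, σ.hom ≫ f = f ∧ σ.hom.hom s₁ = s₂ := by
  obtain ⟨σ, hσ⟩ := hAut s₁ s₂
  refine ⟨σ, ?_, hσ⟩
  apply Action.hom_ext
  refine ConcreteCategory.hom_ext _ _ fun s => ?_
  obtain ⟨g, rfl⟩ := htrans s₁ s
  change f.hom (σ.hom.hom (S.ρ g s₁)) = f.hom (S.ρ g s₁)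
  rw [map_ρ_apply σ.hom, hσ, map_ρ_apply f, map_ρ_apply f, h]

/-- **The regular `G`-set `G/1` (`= Z^log_∞` itself) is Galois**: right translations are automorphisms of the
`G`-set and act transitively. [cite: MochizukiSemiAnbd2006, Rmk. 3.1.3 p.34] -/
theorem exists_aut_apply_eq_leftRegular (s t : (Action.leftRegular G).V) :
    ∃ σ : Aut (Action.leftRegular G), σ.hom.hom s = t := by
  change G at s t
  refine ⟨Action.mkIso (Equiv.mulRight (s⁻¹ * t)).toIso fun g => ?_, ?_⟩
  · refine ConcreteCategory.hom_ext _ _ fun x => ?_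
    change G at x
    change Equiv.mulRight (s⁻¹ * t) ((Action.leftRegular G).ρ g x) =
      (Action.leftRegular G).ρ g (Equiv.mulRight (s⁻¹ * t) x)
    simp only [Equiv.coe_mulRight, Action.ofMulAction_apply, smul_eq_mul, mul_assoc]
  · change s * (s⁻¹ * t) = t
    rw [mul_inv_cancel_left]

/-- In the coset `G`-set `G/N` of a NORMAL subgroup the action is left multiplication in the quotient group.
[cite: MochizukiSemiAnbd2006, Rmk. 3.1.3 p.34] -/
theorem ofMulAction_quotient_ρ_apply (N : Subgroup G) [N.Normal] (g : G) (x : G ⧸ N) :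
    (Action.ofMulAction G (G ⧸ N)).ρ g x = (g : G ⧸ N) * x := by
  rw [Action.ofMulAction_apply]
  induction x using QuotientGroup.induction_on with
  | H a => rw [MulAction.Quotient.smul_coe, smul_eq_mul, QuotientGroup.mk_mul]

/-- **The coset `G`-sets `G/N`, `N ⊴ G` (the Galois coverings `Y^log → X^log` dominated by `Z^log_∞`,
`N = Gal(Z^log_∞/Y^log)`) are Galois**: right translations by elements of the quotient group are automorphisms of
the `G`-set and act transitively. [cite: MochizukiSemiAnbd2006, Rmk. 3.1.3 p.34] -/
theorem exists_aut_apply_eq_quotient (N : Subgroup G) [N.Normal] (s t : (Action.ofMulAction G (G ⧸ N)).V) :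
    ∃ σ : Aut (Action.ofMulAction G (G ⧸ N)), σ.hom.hom s = t := by
  change G ⧸ N at s t
  refine ⟨Action.mkIso (Equiv.mulRight (s⁻¹ * t)).toIso fun g => ?_, ?_⟩
  · refine ConcreteCategory.hom_ext _ _ fun x => ?_
    change G ⧸ N at x
    change Equiv.mulRight (s⁻¹ * t) ((Action.ofMulAction G (G ⧸ N)).ρ g x) =
      (Action.ofMulAction G (G ⧸ N)).ρ g (Equiv.mulRight (s⁻¹ * t) x)
    simp only [Equiv.coe_mulRight, ofMulAction_quotient_ρ_apply, mul_assoc]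
  · change s * (s⁻¹ * t) = t
    rw [mul_inv_cancel_left]

/-- The coset `G`-sets `G/N`, `N ⊴ G`, are deck-transitive over every covering map (Galois ⇒ deck-transitive).
[cite: MochizukiSemiAnbd2006, Rmk. 3.1.3 p.34] -/
theorem exists_deck_quotient (N : Subgroup G) [N.Normal] (f : Action.ofMulAction G (G ⧸ N) ⟶ S')
    {s₁ s₂ : (Action.ofMulAction G (G ⧸ N)).V} (h : f.hom s₁ = f.hom s₂) :
    ∃ σ : Aut (Action.ofMulAction G (G ⧸ N)), σ.hom ≫ f = f ∧ σ.hom.hom s₁ = s₂ :=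
  exists_deck_of_galois (isConnectedGSet_quotient N).2 (exists_aut_apply_eq_quotient N) f h

/-- The regular `G`-set is deck-transitive over every covering map. [cite: MochizukiSemiAnbd2006, Rmk. 3.1.3 p.34] -/
theorem exists_deck_leftRegular (f : Action.leftRegular G ⟶ S') {s₁ s₂ : (Action.leftRegular G).V}
    (h : f.hom s₁ = f.hom s₂) : ∃ σ : Aut (Action.leftRegular G), σ.hom ≫ f = f ∧ σ.hom.hom s₁ = s₂ :=
  exists_deck_of_galois isConnectedGSet_leftRegular.2 exists_aut_apply_eq_leftRegular f h

/-! ## §1′ Descent of deck-invariant functions along a deck-transitive covering map -/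

section Descent

variable (f : S ⟶ S')
  (hdeck : ∀ s₁ s₂ : S.V, f.hom s₁ = f.hom s₂ → ∃ σ : Aut S, σ.hom ≫ f = f ∧ σ.hom.hom s₁ = s₂)

include hdeck in
/-- **A deck-invariant function is constant on the fibres** of a deck-transitive covering map.
[cite: MochizukiEtTh2009, Rmk 4.1.1 p.88] -/
theorem apply_eq_of_deckInvariant {M : Type*} {φ : S.V → M}
    (hφ : ∀ σ : Aut S, σ.hom ≫ f = f → ∀ s, φ (σ.hom.hom s) = φ s) {s₁ s₂ : S.V}
    (h : f.hom s₁ = f.hom s₂) : φ s₁ = φ s₂ := by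
  obtain ⟨σ, hσf, hσ⟩ := hdeck s₁ s₂ h
  rw [← hσ, hφ σ hσf]

include hdeck in
/-- **Existence of the descent**: along a SURJECTIVE deck-transitive covering map every deck-invariant function
descends (the descended function is `t ↦ φ(s)` for any `s ↦ t`). [cite: MochizukiEtTh2009, Rmk 4.1.1 p.88] -/
theorem exists_descent (hf : Function.Surjective f.hom) {M : Type*} (φ : S.V → M)
    (hφ : ∀ σ : Aut S, σ.hom ≫ f = f → ∀ s, φ (σ.hom.hom s) = φ s) :
    ∃ ψ : S'.V → M, ∀ s, ψ (f.hom s) = φ s :=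
  ⟨fun t => φ (Function.surjInv hf t), fun s =>
    apply_eq_of_deckInvariant f hdeck hφ (Function.surjInv_eq hf (f.hom s))⟩

/-- **Uniqueness of the descent** along a surjective covering map. [cite: MochizukiEtTh2009, Rmk 4.1.1 p.88] -/
theorem descent_unique (hf : Function.Surjective f.hom) {M : Type*} {φ : S.V → M} {ψ ψ' : S'.V → M}
    (hψ : ∀ s, ψ (f.hom s) = φ s) (hψ' : ∀ s, ψ' (f.hom s) = φ s) : ψ = ψ' := by
  funext t
  obtain ⟨s, rfl⟩ := hf t
  rw [hψ, hψ']

/-- **The descent of an equivariant function is equivariant** (for any assignment `act` of self-maps of the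
target to the elements of `G` with respect to which `φ` is equivariant). [cite: MochizukiEtTh2009, Rmk 4.1.1 p.88] -/
theorem descent_equivariant (hf : Function.Surjective f.hom) {M : Type*} (act : G → M → M) {φ : S.V → M}
    (hφG : ∀ (g : G) (s : S.V), φ (S.ρ g s) = act g (φ s)) {ψ : S'.V → M} (hψ : ∀ s, ψ (f.hom s) = φ s)
    (g : G) (t : S'.V) : ψ (S'.ρ g t) = act g (ψ t) := by
  obtain ⟨s, rfl⟩ := hf t
  rw [← map_ρ_apply f, hψ, hψ, hφG]

/-! ## §2 (Q): a deck-transitive surjective covering map is a categorical quotient in the `G`-sets -/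

include hdeck in
/-- **(Q) — categorical quotient by the deck group**: along a surjective deck-transitive covering map
`f : S → S′`, every covering map `q : S → Y` invariant under the deck transformations of `f` factors UNIQUELY
through `f` ([FrdI] §0 "categorical quotient"; the input (Q) of `BaseFrobeniusTypeData.existsUnique_fac_of_descent`
read in the `G`-sets). [cite: MochizukiEtTh2009, Rmk 4.1.1 p.88] -/
theorem existsUnique_fac_of_deckInvariant (hf : Function.Surjective f.hom) {Y : Action (Type u) G}
    (q : S ⟶ Y) (hq : ∀ σ : Aut S, σ.hom ≫ f = f → σ.hom ≫ q = q) : ∃! q' : S' ⟶ Y, f ≫ q' = q := by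
  have hq' : ∀ σ : Aut S, σ.hom ≫ f = f → ∀ s, q.hom (σ.hom.hom s) = q.hom s := fun σ hσ s => by
    have e := congrArg (fun r : S ⟶ Y => r.hom s) (hq σ hσ)
    exact e
  obtain ⟨ψ, hψ⟩ := exists_descent f hdeck hf (fun s => q.hom s) hq'
  have hψG : ∀ (g : G) (t : S'.V), ψ (S'.ρ g t) = Y.ρ g (ψ t) :=
    descent_equivariant f hf (fun g y => Y.ρ g y) (fun g s => map_ρ_apply q g s) hψ
  refine ⟨⟨TypeCat.ofHom ψ, fun g => ConcreteCategory.hom_ext _ _ fun t => ?_⟩, ?_, fun q'' hq'' => ?_⟩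
  · change ψ (S'.ρ g t) = Y.ρ g (ψ t)
    exact hψG g t
  · apply Action.hom_ext
    exact ConcreteCategory.hom_ext _ _ fun s => hψ s
  · apply Action.hom_ext
    refine ConcreteCategory.hom_ext _ _ fun t => ?_
    obtain ⟨s, rfl⟩ := hf t
    change q''.hom (f.hom s) = ψ (f.hom s)
    rw [hψ, ← hq'']
    rfl

/-- **(Q) out of a Galois covering**: every covering map `S → S′` out of a GALOIS `G`-set onto a `G`-set is a
categorical quotient by its deck group. [cite: MochizukiEtTh2009, Rmk 4.1.1 p.88] -/
theorem existsUnique_fac_of_galois (htrans : ∀ s t : S.V, ∃ g : G, S.ρ g s = t)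
    (hAut : ∀ s t : S.V, ∃ σ : Aut S, σ.hom.hom s = t) (f : S ⟶ S') (hf : Function.Surjective f.hom)
    {Y : Action (Type u) G} (q : S ⟶ Y) (hq : ∀ σ : Aut S, σ.hom ≫ f = f → σ.hom ≫ q = q) :
    ∃! q' : S' ⟶ Y, f ≫ q' = q :=
  existsUnique_fac_of_deckInvariant f (fun _ _ h => exists_deck_of_galois htrans hAut f h) hf q hq

/-! ## §3 (Φ), (B): deck-invariant log-divisors and log-meromorphic functions descend -/

variable {Z : LogDivisorModel.{u}} (A : Z.GaloisAction G)

include hdeck in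
/-- **(Φ) — descent in `Φ₀ = Hom_G(−, Div⁺(Z^log_∞))`**: along a surjective deck-transitive covering map
`f : S → S′`, an element of `Φ₀(S)` fixed by (pull-back along) every deck transformation of `f` is the pull-back
of a UNIQUE element of `Φ₀(S′)` (Def. 3.3 (iii): `Div⁺(Z_∞)^{H} = (Div⁺(Z_∞)^{H′})^{H/H′}`).
[cite: MochizukiEtTh2009, Def 3.3 p.73] -/
theorem phiZero_existsUnique_descent (hf : Function.Surjective f.hom) (φ : A.phiZero S)
    (hφ : ∀ σ : Aut S, σ.hom ≫ f = f → A.phiZeroPull σ.hom φ = φ) :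
    ∃! φ' : A.phiZero S', A.phiZeroPull f φ' = φ := by
  have hφ' : ∀ σ : Aut S, σ.hom ≫ f = f → ∀ s, φ.1 (σ.hom.hom s) = φ.1 s := fun σ hσ s =>
    congrArg (fun χ : A.phiZero S => χ.1 s) (hφ σ hσ)
  obtain ⟨ψ, hψ⟩ := exists_descent f hdeck hf φ.1 hφ'
  refine ⟨⟨ψ, fun t => ?_, fun g t => descent_equivariant f hf (fun g d => A.actDIV g d) φ.2.2 hψ g t⟩,
    Subtype.ext (funext fun s => hψ s), fun φ'' hφ'' => ?_⟩
  · obtain ⟨s, rfl⟩ := hf t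
    rw [hψ]
    exact φ.2.1 s
  · apply A.phiZeroPull_injective f hf
    rw [hφ'']
    exact (Subtype.ext (funext fun s => hψ s)).symm

include hdeck in
/-- **(B) — descent in `B₀ = Hom_G(−, Mero(Z^log_∞))`**: along a surjective deck-transitive covering map, an
element of `B₀(S)` fixed by every deck transformation of `f` is the pull-back of a UNIQUE element of `B₀(S′)`
(Def. 3.3 (iii): `Mero(Z_∞)^{H} = (Mero(Z_∞)^{H′})^{H/H′}`). [cite: MochizukiEtTh2009, Def 3.3 p.73] -/
theorem bZero_existsUnique_descent (hf : Function.Surjective f.hom) (b : A.bZero S)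
    (hb : ∀ σ : Aut S, σ.hom ≫ f = f → A.bZeroPull σ.hom b = b) :
    ∃! b' : A.bZero S', A.bZeroPull f b' = b := by
  have hb' : ∀ σ : Aut S, σ.hom ≫ f = f → ∀ s, b.1 (σ.hom.hom s) = b.1 s := fun σ hσ s =>
    congrArg (fun χ : A.bZero S => χ.1 s) (hb σ hσ)
  obtain ⟨ψ, hψ⟩ := exists_descent f hdeck hf b.1 hb'
  refine ⟨⟨ψ, fun t => ?_, fun g t => descent_equivariant f hf (fun g x => A.actFn g x) b.2.2 hψ g t⟩,
    Subtype.ext (funext fun s => hψ s), fun b'' hb'' => ?_⟩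
  · obtain ⟨s, rfl⟩ := hf t
    rw [hψ]
    exact b.2.1 s
  · apply A.bZeroPull_injective f hf
    rw [hb'']
    exact (Subtype.ext (funext fun s => hψ s)).symm

/-- `pull` along the functor `Φ₀` is the pull-back of log-divisors. [cite: MochizukiEtTh2009, Def 3.3 p.73] -/
theorem pull_PhiZero (f : S ⟶ S') (φ : A.PhiZero.obj (op S')) : pull A.PhiZero f φ = A.phiZeroPull f φ := rfl

/-- `pull` along the functor `B₀` is the pull-back of log-meromorphic functions. [cite: MochizukiEtTh2009, Def 3.3 p.73] -/
theorem pull_BZero (f : S ⟶ S') (b : A.BZero.obj (op S')) : pull A.BZero f b = A.bZeroPull f b := rfl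

include hdeck in
/-- **(Φ) in the shape consumed by `BaseFrobeniusTypeData.existsUnique_fac_of_descent`** (its binder `hΦ`, read
for the functor `Φ₀` on the `G`-sets): along a surjective deck-transitive covering map, deck-invariant elements
descend AND `pullGp Φ₀ f` is injective (`Φ₀(S)` is cancellative: a submonoid of the group of functions into
`DIV(Z^log_∞)`). [cite: MochizukiEtTh2009, Rmk 4.1.1 p.88] -/
theorem phiZero_galoisDescent (hf : Function.Surjective f.hom) :
    (∀ z : A.PhiZero.obj (op S), (∀ g : Aut S, g.hom ≫ f = f → pull A.PhiZero g.hom z = z) →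
        ∃ z' : A.PhiZero.obj (op S'), pull A.PhiZero f z' = z) ∧
      Function.Injective (pullGp A.PhiZero f) := by
  refine ⟨fun z hz => (phiZero_existsUnique_descent f hdeck A hf z hz).exists, ?_⟩
  have h₁ : IsCancelMul (A.PhiZero.obj (op S)) := by
    change IsCancelMul (A.phiZero S)
    infer_instance
  have h₂ : IsCancelMul (A.PhiZero.obj (op S')) := by
    change IsCancelMul (A.phiZero S')
    infer_instance
  exact gpMap_injective (pull A.PhiZero f) (A.phiZeroPull_injective f hf)

include hdeck in
/-- **(B) in the shape consumed by `BaseFrobeniusTypeData.existsUnique_fac_of_descent`** (its binder `hB`, read for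
the functor `B₀` on the `G`-sets): deck-invariant elements descend AND `pull B₀ f` is injective.
[cite: MochizukiEtTh2009, Rmk 4.1.1 p.88] -/
theorem bZero_galoisDescent (hf : Function.Surjective f.hom) :
    (∀ t : A.BZero.obj (op S), (∀ g : Aut S, g.hom ≫ f = f → pull A.BZero g.hom t = t) →
        ∃ t' : A.BZero.obj (op S'), pull A.BZero f t' = t) ∧
      Function.Injective (pull A.BZero f) :=
  ⟨fun t ht => (bZero_existsUnique_descent f hdeck A hf t ht).exists, A.bZeroPull_injective f hf⟩

/-- **(Φ) and (B) out of a Galois covering** `G/N → S′`, `N ⊴ G`, onto a connected covering `S′`: both descent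
packages hold with NO residual hypothesis. [cite: MochizukiEtTh2009, Rmk 4.1.1 p.88] -/
theorem galoisDescent_quotient (N : Subgroup G) [N.Normal] (hS' : isConnectedGSet S')
    (f : Action.ofMulAction G (G ⧸ N) ⟶ S') :
    ((∀ z : A.PhiZero.obj (op (Action.ofMulAction G (G ⧸ N))),
        (∀ g : Aut (Action.ofMulAction G (G ⧸ N)), g.hom ≫ f = f → pull A.PhiZero g.hom z = z) →
          ∃ z' : A.PhiZero.obj (op S'), pull A.PhiZero f z' = z) ∧
      Function.Injective (pullGp A.PhiZero f)) ∧
    ((∀ t : A.BZero.obj (op (Action.ofMulAction G (G ⧸ N))),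
        (∀ g : Aut (Action.ofMulAction G (G ⧸ N)), g.hom ≫ f = f → pull A.BZero g.hom t = t) →
          ∃ t' : A.BZero.obj (op S'), pull A.BZero f t' = t) ∧
      Function.Injective (pull A.BZero f)) :=
  have hf : Function.Surjective f.hom :=
    hom_surjective_of_isConnectedGSet (isConnectedGSet_quotient N) hS' f
  ⟨phiZero_galoisDescent f (fun _ _ h => exists_deck_quotient N f h) A hf,
    bZero_galoisDescent f (fun _ _ h => exists_deck_quotient N f h) A hf⟩

end Descent

end LogDivisorModel.GaloisAction

/-! ## §4 The assembled Def. 3.3 (iii) records -/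

namespace DivisorMonoids

open LogDivisorModel.GaloisAction

variable {Z : LogDivisorModel.{u}} {G : Type u} [Group G] (A : Z.GaloisAction G) (hZ : Z.CuspLaws)

/-- **(Φ) for `DivisorMonoids.ofGaloisAction`**: along a surjective deck-transitive covering map, a deck-invariant
element of `Φ₀(S)` is `Φ₀(f)` of a unique element of `Φ₀(S′)`. [cite: MochizukiEtTh2009, Def 3.3 p.73] -/
theorem ofGaloisAction_Φ₀_descent {S S' : Action (Type u) G} (f : S ⟶ S') (hf : Function.Surjective f.hom)
    (hdeck : ∀ s₁ s₂ : S.V, f.hom s₁ = f.hom s₂ → ∃ σ : Aut S, σ.hom ≫ f = f ∧ σ.hom.hom s₁ = s₂)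
    (z : (ofGaloisAction A hZ).Φ₀.obj (op S))
    (hz : ∀ σ : Aut S, σ.hom ≫ f = f → ((ofGaloisAction A hZ).Φ₀.map σ.hom.op).hom z = z) :
    ∃! z' : (ofGaloisAction A hZ).Φ₀.obj (op S'), ((ofGaloisAction A hZ).Φ₀.map f.op).hom z' = z :=
  phiZero_existsUnique_descent f hdeck A hf z hz

/-- **(B) for `DivisorMonoids.ofGaloisAction`**: along a surjective deck-transitive covering map, a deck-invariant
element of `B₀(S)` is `B₀(f)` of a unique element of `B₀(S′)`. [cite: MochizukiEtTh2009, Def 3.3 p.73] -/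
theorem ofGaloisAction_B₀_descent {S S' : Action (Type u) G} (f : S ⟶ S') (hf : Function.Surjective f.hom)
    (hdeck : ∀ s₁ s₂ : S.V, f.hom s₁ = f.hom s₂ → ∃ σ : Aut S, σ.hom ≫ f = f ∧ σ.hom.hom s₁ = s₂)
    (t : (ofGaloisAction A hZ).B₀.obj (op S))
    (ht : ∀ σ : Aut S, σ.hom ≫ f = f → ((ofGaloisAction A hZ).B₀.map σ.hom.op).hom t = t) :
    ∃! t' : (ofGaloisAction A hZ).B₀.obj (op S'), ((ofGaloisAction A hZ).B₀.map f.op).hom t' = t :=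
  bZero_existsUnique_descent f hdeck A hf t ht

end DivisorMonoids

end Literature.AnabelianGeometry.EtaleTheta
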